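import Mathlib.Analysis.Calculus.Deriv.Add
import Mathlib.Analysis.Calculus.Deriv.Mul
import Literature.Analysis.FluidPDE.HardSphereCollisionRecord
import Literature.MathematicalPhysics.KineticTheory.HardSphereEuler
import HarnessLib

/-!
# Cluster virial identities (helper for stub `stub_clusterVirialBudget`)

Crux `Summit.AtomisticToContinuum.HydrodynamicLimit.Theses.AntiMazurCoboundaries.KineticWindowGronwall`
(stmt-AtomisticToContinuum-9282), line `explosion-limited-jamming`, stub `stub_clusterVirialBudget :
ClusterVirialBudget` (file `AntiMazurCoboundariesKineticWindowGronwallClusterVirialBudget`). This helper file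
carries the centre-of-mass cluster quantities of the line skeleton
(`Cruxes/KineticWindowGronwall/Lines/explosion-limited-jamming.lean`, re-declared verbatim: `cmPos`,
`cmVel`, `cmVirial`, `cmInertia`, `cmKinetic`) and the configuration-level
Lagrange–Jacobi (Clausius virial) identities behind Cercignani–Illner–Pulvirenti 1994, Lemma 4.2.3
(Vaserstein 1979; Illner 1989):

* `Σ_{a∈S} (x_a − X_S) = 0`, `b_S = Σ_{a∈S} ⟪x_a − X_S, v_a⟫`, Cauchy–Schwarz `|b_S| ≤ √(2 K_S I_S)`;
* free flight: `b_S(S_s z) = b_S + 2 K_S s`, `I_S(S_s z) = I_S + 2 b_S s + 2 K_S s² ≤ (√I_S + √(2K_S) s)²`,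
  `K_S` constant, whence `√I_S(S_s z) ≤ √I_S + √(2 K_S) s` for `s ≥ 0`, and the streaming derivative
  `d/ds b_S(S_s z) = 2 K_S`;
* a jump of the velocities of one pair `{i, j}` conserving the pair momentum (and energy): the mean velocity
  and `K_S` are unchanged when the pair is inside or outside `S`, and
  `Δb_S = [i ∈ S] ⟪x_i − X_S, Δv_i⟫ + [j ∈ S] ⟪x_j − X_S, Δv_j⟫`.
-/

noncomputable section

open scoped BigOperators ENNReal InnerProductSpace
open MeasureTheory Set Filter Topology Function
open Literature.MathematicalPhysics.KineticTheory (V3)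
open Literature.Analysis.FluidPDE

namespace Summit.AtomisticToContinuum.HydrodynamicLimit.Theorems.KineticWindowGronwallClusterVirial


/-! ## Centre-of-mass cluster quantities (verbatim from the line skeleton) -/

section Cluster

open scoped Classical

variable {n : ℕ}

/-- Centre of mass of the cluster `S`. [cite: CIP1994, Lemma 4.2.3] -/
def cmPos (S : Finset (Fin n)) (z : Config n (Fin 3) V3) : V3 := (S.card : ℝ)⁻¹ • ∑ a ∈ S, (z a).1

/-- Mean velocity of the cluster `S`. [cite: CIP1994, Lemma 4.2.3] -/
def cmVel (S : Finset (Fin n)) (z : Config n (Fin 3) V3) : V3 := (S.card : ℝ)⁻¹ • ∑ a ∈ S, (z a).2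

/-- The centre-of-mass VIRIAL `b_S = Σ_{a∈S} ⟪x_a − X_S, v_a − V_S⟫` (half the time derivative of
`cmInertia` in flight; the tree's `Literature.Barriers.AtomisticToContinuum.virial` is the `S = univ`,
origin-centred version). [cite: CIP1994, Lemma 4.2.3] -/
def cmVirial (S : Finset (Fin n)) (z : Config n (Fin 3) V3) : ℝ :=
  ∑ a ∈ S, inner ℝ ((z a).1 - cmPos S z) ((z a).2 - cmVel S z)

/-- Moment of inertia about the centre of mass, `I_S = Σ_{a∈S} ‖x_a − X_S‖²`.
[cite: CIP1994, Lemma 4.2.3] -/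
def cmInertia (S : Finset (Fin n)) (z : Config n (Fin 3) V3) : ℝ :=
  ∑ a ∈ S, ‖(z a).1 - cmPos S z‖ ^ 2

/-- Kinetic energy in the centre-of-mass frame, `K_S = ½ Σ_{a∈S} ‖v_a − V_S‖²`.
[cite: CIP1994, Lemma 4.2.3] -/
def cmKinetic (S : Finset (Fin n)) (z : Config n (Fin 3) V3) : ℝ :=
  2⁻¹ * ∑ a ∈ S, ‖(z a).2 - cmVel S z‖ ^ 2

end Cluster

/-! ## Algebra of the cluster quantities -/

section Algebra

variable {n : ℕ} (S : Finset (Fin n))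

/-- Shorthand for the Euclidean geometry of `ℝ³`. [folklore] -/
local notation "G3" => Euclidean.geometry (Fin 3)

/-- The relative positions sum to zero: `Σ_{a∈S} (x_a − X_S) = 0`. [folklore] -/
theorem sum_sub_cmPos (z : Config n (Fin 3) V3) : ∑ a ∈ S, ((z a).1 - cmPos S z) = 0 := by
  rw [Finset.sum_sub_distrib, Finset.sum_const, cmPos, ← Nat.cast_smul_eq_nsmul ℝ, smul_smul]
  rcases Nat.eq_zero_or_pos S.card with h0 | hpos
  · rw [Finset.card_eq_zero.1 h0]
    simp
  · rw [mul_inv_cancel₀ (Nat.cast_ne_zero.2 (Nat.pos_iff_ne_zero.1 hpos)), one_smul, sub_self]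

/-- The virial only needs the relative positions: `b_S = Σ_{a∈S} ⟪x_a − X_S, v_a⟫`. [folklore] -/
theorem cmVirial_eq_sum_inner (z : Config n (Fin 3) V3) :
    cmVirial S z = ∑ a ∈ S, ⟪(z a).1 - cmPos S z, (z a).2⟫_ℝ := by
  unfold cmVirial
  simp only [inner_sub_right]
  rw [Finset.sum_sub_distrib, ← sum_inner, sum_sub_cmPos, inner_zero_left, sub_zero]

/-- The CM kinetic energy is nonnegative. [folklore] -/
theorem cmKinetic_nonneg (z : Config n (Fin 3) V3) : 0 ≤ cmKinetic S z :=
  mul_nonneg (by norm_num) (Finset.sum_nonneg fun _ _ => sq_nonneg _)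

/-- The CM moment of inertia is nonnegative. [folklore] -/
theorem cmInertia_nonneg (z : Config n (Fin 3) V3) : 0 ≤ cmInertia S z :=
  Finset.sum_nonneg fun _ _ => sq_nonneg _

/-- `√(2 K_S I_S) = √(2 K_S) · √I_S`. [folklore] -/
theorem sqrt_two_mul_cmKinetic_mul (z : Config n (Fin 3) V3) :
    Real.sqrt (2 * cmKinetic S z * cmInertia S z) =
      Real.sqrt (2 * cmKinetic S z) * Real.sqrt (cmInertia S z) :=
  Real.sqrt_mul (mul_nonneg zero_le_two (cmKinetic_nonneg S z)) _

/-- **Cauchy–Schwarz for the virial**: `|b_S| ≤ √(2 K_S I_S)`. [folklore] -/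
theorem abs_cmVirial_le (z : Config n (Fin 3) V3) :
    |cmVirial S z| ≤ Real.sqrt (2 * cmKinetic S z * cmInertia S z) := by
  have h2 : 2 * cmKinetic S z = ∑ a ∈ S, ‖(z a).2 - cmVel S z‖ ^ 2 := by
    rw [cmKinetic, ← mul_assoc, mul_inv_cancel₀ two_ne_zero, one_mul]
  calc |cmVirial S z| ≤ ∑ a ∈ S, |⟪(z a).1 - cmPos S z, (z a).2 - cmVel S z⟫_ℝ| :=
        Finset.abs_sum_le_sum_abs _ _
    _ ≤ ∑ a ∈ S, ‖(z a).2 - cmVel S z‖ * ‖(z a).1 - cmPos S z‖ :=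
        Finset.sum_le_sum fun a _ => (abs_real_inner_le_norm _ _).trans_eq (mul_comm _ _)
    _ ≤ Real.sqrt (∑ a ∈ S, ‖(z a).2 - cmVel S z‖ ^ 2) *
          Real.sqrt (∑ a ∈ S, ‖(z a).1 - cmPos S z‖ ^ 2) := Real.sum_mul_le_sqrt_mul_sqrt _ _ _
    _ = Real.sqrt (2 * cmKinetic S z * cmInertia S z) := by
        rw [sqrt_two_mul_cmKinetic_mul, h2, cmInertia]

/-- `b_S ≤ √(2 K_S I_S)`. [folklore] -/
theorem cmVirial_le (z : Config n (Fin 3) V3) :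
    cmVirial S z ≤ Real.sqrt (2 * cmKinetic S z * cmInertia S z) :=
  (le_abs_self _).trans (abs_cmVirial_le S z)

/-! ### Free flight -/

/-- Free flight keeps the mean velocity. [folklore] -/
theorem cmVel_freeFlight (s : ℝ) (z : Config n (Fin 3) V3) : cmVel S (freeFlight G3 s z) = cmVel S z := by
  simp [cmVel]

/-- Free flight moves the centre of mass at the mean velocity. [folklore] -/
theorem cmPos_freeFlight (s : ℝ) (z : Config n (Fin 3) V3) :
    cmPos S (freeFlight G3 s z) = cmPos S z + s • cmVel S z := by
  simp only [cmPos, cmVel, freeFlight_apply, Euclidean.geometry_translate, Finset.sum_add_distrib,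
    smul_add, ← Finset.smul_sum, smul_comm s]

/-- Relative positions in free flight: `(x_a + s v_a) − X_S(s) = (x_a − X_S) + s (v_a − V_S)`. [folklore] -/
theorem freeFlight_fst_sub_cmPos (s : ℝ) (z : Config n (Fin 3) V3) (a : Fin n) :
    (freeFlight G3 s z a).1 - cmPos S (freeFlight G3 s z) =
      ((z a).1 - cmPos S z) + s • ((z a).2 - cmVel S z) := by
  rw [cmPos_freeFlight, freeFlight_apply, Euclidean.geometry_translate, smul_sub]
  exact add_sub_add_comm _ _ _ _

/-- Free flight keeps the CM kinetic energy. [folklore] -/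
theorem cmKinetic_freeFlight (s : ℝ) (z : Config n (Fin 3) V3) :
    cmKinetic S (freeFlight G3 s z) = cmKinetic S z := by
  simp only [cmKinetic, cmVel_freeFlight, freeFlight_apply]

/-- **Lagrange's identity in free flight**: `b_S(S_s z) = b_S(z) + s · 2 K_S(z)`. [folklore] -/
theorem cmVirial_freeFlight (s : ℝ) (z : Config n (Fin 3) V3) :
    cmVirial S (freeFlight G3 s z) = cmVirial S z + s * (2 * cmKinetic S z) := by
  have h2 : 2 * cmKinetic S z = ∑ a ∈ S, ‖(z a).2 - cmVel S z‖ ^ 2 := by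
    rw [cmKinetic, ← mul_assoc, mul_inv_cancel₀ two_ne_zero, one_mul]
  rw [h2, cmVirial, cmVirial, Finset.mul_sum, ← Finset.sum_add_distrib]
  refine Finset.sum_congr rfl fun a _ => ?_
  rw [freeFlight_fst_sub_cmPos, cmVel_freeFlight, freeFlight_apply, inner_add_left, real_inner_smul_left,
    real_inner_self_eq_norm_sq]

/-- The moment of inertia in free flight: `I_S(S_s z) = I_S + 2 s b_S + s² · 2 K_S`. [folklore] -/
theorem cmInertia_freeFlight (s : ℝ) (z : Config n (Fin 3) V3) :
    cmInertia S (freeFlight G3 s z) =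
      cmInertia S z + 2 * s * cmVirial S z + s ^ 2 * (2 * cmKinetic S z) := by
  have h2 : 2 * cmKinetic S z = ∑ a ∈ S, ‖(z a).2 - cmVel S z‖ ^ 2 := by
    rw [cmKinetic, ← mul_assoc, mul_inv_cancel₀ two_ne_zero, one_mul]
  rw [h2, cmInertia, cmInertia, cmVirial, Finset.mul_sum, Finset.mul_sum, ← Finset.sum_add_distrib,
    ← Finset.sum_add_distrib]
  refine Finset.sum_congr rfl fun a _ => ?_
  rw [freeFlight_fst_sub_cmPos, norm_add_sq_real, norm_smul, mul_pow, Real.norm_eq_abs, sq_abs,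
    real_inner_smul_right]
  ring

/-- **The moment of inertia grows at most quadratically in free flight**: for `s ≥ 0`,
`I_S(S_s z) ≤ (√I_S + √(2K_S) s)²`. [folklore] -/
theorem cmInertia_freeFlight_le_sq {s : ℝ} (hs : 0 ≤ s) (z : Config n (Fin 3) V3) :
    cmInertia S (freeFlight G3 s z) ≤
      (Real.sqrt (cmInertia S z) + Real.sqrt (2 * cmKinetic S z) * s) ^ 2 := by
  have hI := cmInertia_nonneg S z
  have hK : 0 ≤ 2 * cmKinetic S z := mul_nonneg zero_le_two (cmKinetic_nonneg S z)
  have hb : cmVirial S z ≤ Real.sqrt (2 * cmKinetic S z) * Real.sqrt (cmInertia S z) := by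
    rw [← sqrt_two_mul_cmKinetic_mul]; exact cmVirial_le S z
  rw [cmInertia_freeFlight, add_sq, mul_pow, Real.sq_sqrt hI, Real.sq_sqrt hK]
  nlinarith [mul_le_mul_of_nonneg_left hb hs]

/-- **Sublinear growth of the gyration radius in free flight**: for `s ≥ 0`,
`√I_S(S_s z) ≤ √I_S(z) + √(2K_S(z)) s`. [folklore] -/
theorem sqrt_cmInertia_freeFlight_le {s : ℝ} (hs : 0 ≤ s) (z : Config n (Fin 3) V3) :
    Real.sqrt (cmInertia S (freeFlight G3 s z)) ≤
      Real.sqrt (cmInertia S z) + Real.sqrt (2 * cmKinetic S z) * s := by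
  have hnn : 0 ≤ Real.sqrt (cmInertia S z) + Real.sqrt (2 * cmKinetic S z) * s :=
    add_nonneg (Real.sqrt_nonneg _) (mul_nonneg (Real.sqrt_nonneg _) hs)
  calc Real.sqrt (cmInertia S (freeFlight G3 s z))
      ≤ Real.sqrt ((Real.sqrt (cmInertia S z) + Real.sqrt (2 * cmKinetic S z) * s) ^ 2) :=
        Real.sqrt_le_sqrt (cmInertia_freeFlight_le_sq S hs z)
    _ = _ := Real.sqrt_sq hnn

/-- The streaming derivative of the virial is twice the CM kinetic energy. [folklore] -/
theorem hasDerivAt_cmVirial_freeFlight (z : Config n (Fin 3) V3) (t : ℝ) :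
    HasDerivAt (fun s => cmVirial S (freeFlight G3 s z)) (2 * cmKinetic S (freeFlight G3 t z)) t := by
  have hfun : (fun s => cmVirial S (freeFlight G3 s z)) =
      fun s => cmVirial S z + s * (2 * cmKinetic S z) := funext fun s => cmVirial_freeFlight S s z
  rw [hfun, cmKinetic_freeFlight]
  simpa using ((hasDerivAt_id t).mul_const (2 * cmKinetic S z)).const_add (cmVirial S z)


/-! ### Binary collisions (two configurations differing by the jump of one pair) -/

section Collision

variable {S} {i j : Fin n} {z z' : Config n (Fin 3) V3}

/-- A sum over `S` of a function supported on the pair `{i, j}`. [folklore] -/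
theorem sum_eq_ite_add_ite {M : Type*} [AddCommMonoid M] (S : Finset (Fin n)) (hij : i ≠ j) {f : Fin n → M}
    (hf : ∀ k, k ≠ i → k ≠ j → f k = 0) :
    ∑ a ∈ S, f a = (if i ∈ S then f i else 0) + (if j ∈ S then f j else 0) := by
  have h1 : ∑ a ∈ S, f a = ∑ a, (if a ∈ S then f a else 0) := by
    rw [← Finset.sum_filter, Finset.filter_univ_mem]
  rw [h1, Fintype.sum_eq_add i j hij]
  intro c hc
  rw [hf c hc.1 hc.2, ite_self]

/-- Equal positions give equal centres of mass. [folklore] -/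
theorem cmPos_eq_of_pos_eq (hpos : ∀ k, (z k).1 = (z' k).1) : cmPos S z = cmPos S z' := by
  simp only [cmPos, hpos]

/-- Equal positions give equal moments of inertia. [folklore] -/
theorem cmInertia_eq_of_pos_eq (hpos : ∀ k, (z k).1 = (z' k).1) : cmInertia S z = cmInertia S z' := by
  simp only [cmInertia, hpos, cmPos_eq_of_pos_eq hpos]

/-- A momentum-conserving jump of the pair `{i, j}` keeps the mean velocity of `S` when the pair is inside or
outside `S`. [folklore] -/
theorem cmVel_eq_of_collision (hij : i ≠ j) (hoth : ∀ k, k ≠ i → k ≠ j → z' k = z k)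
    (hmom : (z' i).2 + (z' j).2 = (z i).2 + (z j).2) (hS : i ∈ S ↔ j ∈ S) : cmVel S z' = cmVel S z := by
  have hsum : ∑ a ∈ S, ((z' a).2 - (z a).2) = 0 := by
    rw [sum_eq_ite_add_ite S hij (f := fun a => (z' a).2 - (z a).2) fun k hki hkj => by
      rw [hoth k hki hkj, sub_self]]
    by_cases hi : i ∈ S
    · rw [if_pos hi, if_pos (hS.1 hi), sub_add_sub_comm, hmom, sub_self]
    · rw [if_neg hi, if_neg (fun hj => hi (hS.2 hj)), add_zero]
  rw [Finset.sum_sub_distrib, sub_eq_zero] at hsum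
  rw [cmVel, cmVel, hsum]

/-- An elastic (momentum- and energy-conserving) jump of the pair `{i, j}` keeps the CM kinetic energy of `S`
when the pair is inside or outside `S`. [folklore] -/
theorem cmKinetic_eq_of_collision (hij : i ≠ j) (hoth : ∀ k, k ≠ i → k ≠ j → z' k = z k)
    (hmom : (z' i).2 + (z' j).2 = (z i).2 + (z j).2)
    (hen : ‖(z' i).2‖ ^ 2 + ‖(z' j).2‖ ^ 2 = ‖(z i).2‖ ^ 2 + ‖(z j).2‖ ^ 2) (hS : i ∈ S ↔ j ∈ S) :
    cmKinetic S z' = cmKinetic S z := by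
  have hV := cmVel_eq_of_collision hij hoth hmom hS
  unfold cmKinetic
  rw [hV, ← sub_eq_zero, ← mul_sub, ← Finset.sum_sub_distrib,
    sum_eq_ite_add_ite S hij (f := fun a => ‖(z' a).2 - cmVel S z‖ ^ 2 - ‖(z a).2 - cmVel S z‖ ^ 2)
      fun k hki hkj => by rw [hoth k hki hkj, sub_self]]
  by_cases hi : i ∈ S
  · rw [if_pos hi, if_pos (hS.1 hi)]
    have hinner : ⟪(z' i).2, cmVel S z⟫_ℝ + ⟪(z' j).2, cmVel S z⟫_ℝ =
        ⟪(z i).2, cmVel S z⟫_ℝ + ⟪(z j).2, cmVel S z⟫_ℝ := by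
      rw [← inner_add_left, ← inner_add_left, hmom]
    simp only [norm_sub_sq_real]
    linear_combination (2⁻¹ : ℝ) * hen - hinner
  · rw [if_neg hi, if_neg (fun hj => hi (hS.2 hj)), add_zero, mul_zero]

/-- **The jump of the virial**: if `z'` differs from `z` only in the velocities of `i, j`, then
`b_S(z') − b_S(z) = [i ∈ S] ⟪x_i − X_S, Δv_i⟫ + [j ∈ S] ⟪x_j − X_S, Δv_j⟫` (the `ΔV_S` term is killed by
`Σ_{a∈S} (x_a − X_S) = 0`). [folklore] -/
theorem cmVirial_sub_of_collision (hij : i ≠ j) (hpos : ∀ k, (z k).1 = (z' k).1)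
    (hoth : ∀ k, k ≠ i → k ≠ j → z' k = z k) :
    cmVirial S z' - cmVirial S z =
      (if i ∈ S then ⟪(z' i).1 - cmPos S z', (z' i).2 - (z i).2⟫_ℝ else 0) +
      (if j ∈ S then ⟪(z' j).1 - cmPos S z', (z' j).2 - (z j).2⟫_ℝ else 0) := by
  rw [cmVirial_eq_sum_inner, cmVirial_eq_sum_inner, ← Finset.sum_sub_distrib]
  simp only [hpos, cmPos_eq_of_pos_eq hpos, ← inner_sub_right]
  exact sum_eq_ite_add_ite S hij fun k hki hkj => by rw [hoth k hki hkj, sub_self, inner_zero_right]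

/-- A vector `v = c n` with `0 < ⟪n, v⟫` points along `n`: `⟪n, v⟫ = ‖n‖ ‖v‖`. [folklore] -/
theorem inner_eq_norm_mul_norm_of_eq_smul {u v : V3} {c : ℝ} (hv : v = c • u) (hp : 0 < ⟪u, v⟫_ℝ) :
    ⟪u, v⟫_ℝ = ‖u‖ * ‖v‖ := by
  subst hv
  rw [real_inner_smul_right, real_inner_self_eq_norm_sq] at hp ⊢
  have hc : 0 < c := by
    by_contra hc
    exact absurd hp (not_lt.2 (mul_nonpos_of_nonpos_of_nonneg (not_lt.1 hc) (sq_nonneg _)))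
  rw [norm_smul, Real.norm_eq_abs, abs_of_pos hc]
  ring

end Collision

end Algebra

/-! ## The helper stub -/

/-- **CLUSTER VIRIAL IDENTITIES** (helper stub `stub_clusterVirialIdentity` registered on the crux item for this
file, which serves `stub_clusterVirialBudget` of line `explosion-limited-jamming`; it packages the lemmas above):
(free flight) `K_S` is constant, `b_S` grows at rate `2 K_S` (Lagrange's identity, also as a derivative), `I_S` is the
quadratic `I_S + 2 b_S s + 2 K_S s²`, `|b_S| ≤ √(2 K_S I_S)` and `√I_S(S_s z) ≤ √I_S + √(2K_S) s` for `s ≥ 0`;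
(collision of one pair `{i, j}` at fixed positions) `I_S` is unchanged, `Δb_S = 1_{i ∈ S} ⟪x_i − X_S, Δv_i⟫ +
1_{j ∈ S} ⟪x_j − X_S, Δv_j⟫`, and `K_S` is unchanged if the jump conserves the pair's momentum and energy and the pair
does not straddle `S`; (alignment) `v = c u`, `0 < ⟪u, v⟫ ⇒ ⟪u, v⟫ = ‖u‖ ‖v‖`. Proved below
(`stub_clusterVirialIdentity`); Cercignani–Illner–Pulvirenti 1994, Lemma 4.2.3 (Lagrange–Jacobi identity). -/
def ClusterVirialIdentity : Prop :=
  (∀ (n : ℕ) (S : Finset (Fin n)) (s : ℝ) (z : Config n (Fin 3) V3),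
    cmKinetic S (freeFlight (Euclidean.geometry (Fin 3)) s z) = cmKinetic S z ∧
    cmVirial S (freeFlight (Euclidean.geometry (Fin 3)) s z) = cmVirial S z + s * (2 * cmKinetic S z) ∧
    cmInertia S (freeFlight (Euclidean.geometry (Fin 3)) s z) =
      cmInertia S z + 2 * s * cmVirial S z + s ^ 2 * (2 * cmKinetic S z) ∧
    HasDerivAt (fun t => cmVirial S (freeFlight (Euclidean.geometry (Fin 3)) t z))
      (2 * cmKinetic S (freeFlight (Euclidean.geometry (Fin 3)) s z)) s ∧
    |cmVirial S z| ≤ Real.sqrt (2 * cmKinetic S z * cmInertia S z) ∧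
    (0 ≤ s → Real.sqrt (cmInertia S (freeFlight (Euclidean.geometry (Fin 3)) s z)) ≤
      Real.sqrt (cmInertia S z) + Real.sqrt (2 * cmKinetic S z) * s)) ∧
  (∀ (n : ℕ) (S : Finset (Fin n)) (i j : Fin n) (z z' : Config n (Fin 3) V3), i ≠ j →
    (∀ k, (z k).1 = (z' k).1) → (∀ k, k ≠ i → k ≠ j → z' k = z k) →
    cmInertia S z = cmInertia S z' ∧
    cmVirial S z' - cmVirial S z =
      (if i ∈ S then inner ℝ ((z' i).1 - cmPos S z') ((z' i).2 - (z i).2) else 0) +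
      (if j ∈ S then inner ℝ ((z' j).1 - cmPos S z') ((z' j).2 - (z j).2) else 0) ∧
    ((z' i).2 + (z' j).2 = (z i).2 + (z j).2 →
      ‖(z' i).2‖ ^ 2 + ‖(z' j).2‖ ^ 2 = ‖(z i).2‖ ^ 2 + ‖(z j).2‖ ^ 2 → (i ∈ S ↔ j ∈ S) →
      cmKinetic S z' = cmKinetic S z)) ∧
  (∀ (u v : V3) (c : ℝ), v = c • u → 0 < inner ℝ u v → inner ℝ u v = ‖u‖ * ‖v‖)

/-- **HELPER STUB `stub_clusterVirialIdentity`** (serves `stub_clusterVirialBudget`, crux `KineticWindowGronwall`,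
stmt-AtomisticToContinuum-9282): the configuration-level cluster virial identities. [cite: CIP1994, Lemma 4.2.3] -/
theorem stub_clusterVirialIdentity : ClusterVirialIdentity :=
  ⟨fun _ S s z => ⟨cmKinetic_freeFlight S s z, cmVirial_freeFlight S s z, cmInertia_freeFlight S s z,
      hasDerivAt_cmVirial_freeFlight S z s, abs_cmVirial_le S z, fun hs => sqrt_cmInertia_freeFlight_le S hs z⟩,
    fun _ _ _ _ _ _ hij hpos hoth => ⟨cmInertia_eq_of_pos_eq hpos, cmVirial_sub_of_collision hij hpos hoth,
      fun hmom hen hS => cmKinetic_eq_of_collision hij hoth hmom hen hS⟩,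
    fun _ _ _ hv hp => inner_eq_norm_mul_norm_of_eq_smul hv hp⟩

end Summit.AtomisticToContinuum.HydrodynamicLimit.Theorems.KineticWindowGronwallClusterVirial

end
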